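import Literature.NumberTheory.GaloisCohomology.LocalInvariantMap
import Literature.NumberTheory.GaloisRepresentations.ArchimedeanLocalDuality
import Literature.NumberTheory.GaloisRepresentations.TateH2VanishingArchimedean
import Literature.NumberTheory.GaloisCohomology.PoitouTateSelmerStructuresRealPlaces
import Mathlib.LinearAlgebra.Complex.Module
import HarnessLib

/-!
# The local invariant map at an infinite place: `inv_w : H²(K_w, μₙ) ↪ ℤ/n`

Let `K` be a number field, `n ≥ 1` and `w` an infinite place, `K_w ≅ ℝ` or `ℂ`, so that
`Γ_{K_w} = Gal(K̄_w/K_w)` has order `≤ 2` (`natCard_absoluteGaloisGroup_completion_infinitePlace_le_two`)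
and its non-trivial element (if any) acts on `μₙ` by `ζ ↦ ζ⁻¹`
(`mu_absGaloisRestrict_eq_neg_infinitePlace`).  In the global class formation the invariant map at a
real place is "the unique injection" `inv_w : Br(ℝ) = H²(Gal(ℂ/ℝ), ℂˣ) = ℝˣ/ℝ_{>0} ⥲ ½ℤ/ℤ ↪ ℚ/ℤ`
(Milne, *ADT* I Ex. 1.6 (c), Thm. 2.13; Serre, *Corps locaux* XIII §3 Remarque; Cassels–Fröhlich VII
§11.2), and at a complex place `Br(ℂ) = 0`.  On `H²(K_w, μₙ) = Br(K_w)[n]` (Hilbert 90) this is, for a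
group `Γ = {1, c}` of order two, the classical isomorphism `H²(Γ, A) ≅ Ĥ⁰(Γ, A) = A^Γ / N_Γ A`,
`[φ] ↦ φ(c, c) + φ(1, 1)` on inhomogeneous cocycles; for `A = μₙ` with `c = -1`:
`A^Γ = μₙ[2]`, `N_Γ A = 0`, so the class is read in `μₙ[2] = {0, n/2} ⊆ ℤ/n`.

This file CONSTRUCTS that map on the tree's object `H²(Γ_{K_w}, μₙ(K̄)|_{Γ_{K_w}})`
(`galoisCohomology ((mu K n).toLocal (Sum.inl w)) 2`, the `w`-component of a family
`LocalInvariants K n` of `PoitouTate.lean`):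

* `twoCocycleDiagonal X φ` — for a topological `G`-module `X` and a continuous `2`-cocycle `φ`, the
  element `φ(c, c) + φ(1, 1)` if `G` has an element `c ≠ 1`, and `0` if `G` is trivial (definition by
  cases; for `|G| ≤ 2` the element `c` is unique, `twoCocycleDiagonal_of_ne_one`).  PROVED for
  `|G| ≤ 2` with the non-trivial element acting as `-1`: additivity, vanishing on coboundaries
  (`twoCocycleDiagonal_eq_zero_of_twoCocycleClass_eq_zero`: a coboundary `σ b(τ) - b(στ) + b(σ)` has
  diagonal `(1 + c) b(c) = 0`), and conversely `twoCocycleClass_eq_zero_of_twoCocycleDiagonal_eq_zero`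
  (if `φ(c, c) = -φ(1, 1)` then `φ` is the coboundary of the constant cochain `φ(1, 1)`, using
  `φ(1, τ) = φ(1, 1)`, `φ(σ, 1) = σ φ(1, 1)`).
* `muCarrierZModEquiv K n : μₙ(K̄) ≃+ ℤ/n` — a group isomorphism (`μₙ(K̄)` is cyclic of order `n`);
  any two agree on `μₙ[2]`, the only values that occur below.
* `archimedeanInvariantMap K n w : H²(Γ_{K_w}, μₙ(K̄)|) →+ ℤ/n` — **definition with body**:
  `[φ] ↦ muCarrierZModEquiv (twoCocycleDiagonal φ)`, well defined by the two vanishing statements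
  (`archimedeanInvariantMap_twoCocycleClass`).  PROVED: it vanishes when `Γ_{K_w}` is trivial
  (`archimedeanInvariantMap_eq_zero_of_forall_eq_one`), and it is INJECTIVE as soon as `Γ_{K_w}` has a
  non-trivial element (`archimedeanInvariantMap_injective_of_ne_one`), in particular at every real
  place (`exists_ne_one_absoluteGaloisGroup_of_isReal`, `archimedeanInvariantMap_injective_of_isReal`)
  — the "unique injection" of Milne I Ex. 1.6 (c).
* `LocalInvariants.canonical K n : LocalInvariants K n` — **THE family of local invariant maps of the
  global class formation at level `n`**: `localInvariantMap K n v` (file `LocalInvariantMap.lean`, the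
  residue map of local class field theory) at the finite places, `archimedeanInvariantMap K n w` at
  the infinite ones; `LocalInvariants.canonical_isPerfect` (local Tate duality at the finite places),
  and the reduction `poitouTate_sum_localTatePairing_eq_zero_of_canonical`: **the named fact
  `poitouTate_sum_localTatePairing_eq_zero K` follows from the single statement
  `∀ n, (LocalInvariants.canonical K n).SumInvLocalizationEqZero`** — the reciprocity law
  `∑_v inv_v = 0` of the Brauer group (Albert–Brauer–Hasse–Noether; Tate, Cassels–Fröhlich VII §11.2
  (bis); Harari Thm. 14.11) for THE invariant maps, which is what remains to be proved in the tree.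
* (appended) `rho_twoCocycleDiagonal` (the diagonal is `G`-invariant), `two_nsmul_twoCocycleDiagonal`,
  `two_nsmul_archimedeanInvariantMap` (the values of `inv_w` lie in the `2`-torsion `{0, n/2}` of
  `ℤ/n`, `Br(ℝ) = ½ℤ/ℤ`), `eq_one_absoluteGaloisGroup_of_isComplex` (`Γ_{K_w} = 1` at a COMPLEX place:
  `K_w ≅ ℂ` is an algebraic closure of itself), `archimedeanInvariantMap_eq_zero_of_isComplex`,
  `LocalInvariants.canonical_inl_eq_zero_of_isComplex` (`inv_w = 0` at the complex places).

## Design notes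

* That `Γ_{K_w}` is non-trivial at a REAL place is proved here
  (`exists_ne_one_absoluteGaloisGroup_of_isReal`: complex conjugation transported along
  `K̄_w ≃ ℂ`), so `LocalInvariants.InjectiveAtRealPlaces (canonical K n)` holds
  (`LocalInvariants.canonical_injectiveAtRealPlaces`) — the archimedean clause of the sibling fact
  `poitouTate_selmerStructure_duality_real` (`PoitouTateSelmerStructuresRealPlaces.lean`).
* `muCarrierZModEquiv` is a choice of isomorphism `μₙ(K̄) ≅ ℤ/n` (the pattern of
  `ArchimedeanLocalDuality.tateDualEval_injective`); the values of `twoCocycleDiagonal` lie in the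
  `c`-invariants `μₙ[2]`, on which all such isomorphisms agree, so `archimedeanInvariantMap` does
  not depend on the choice (not needed below, not proved).
* No named fact, no instance (D-0026).

## References

* J. S. Milne, *Arithmetic Duality Theorems*, 2nd ed. (2006), Ch. I: Ex. 1.6 (c) (p. 19),
  Thm. 2.13 (a) (p. 35), §4 (p. 55), Thm. 4.10 (b). [MilneADT2006]
* J.-P. Serre, *Corps locaux* (1968) / *Local Fields* (1979), VIII §4 (cohomology of finite cyclic
  groups), XIII §3. [SerreLocalFields1979]
* J.-P. Serre, *Cohomologie galoisienne* (1997), I §2.3, I §2.4 (`G = Gal(ℂ/ℝ)`).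
  [SerreGaloisCohomology1997]
* D. Harari, *Galois Cohomology and Class Field Theory* (2020), Thm. 14.11. [Harari2020]

## Tree search

`lean search 'archimedeanInvariantMap|twoCocycleDiagonal|LocalInvariants.canonical'`: no prior
declaration.  Inputs: `contTwoCocycles`, `twoCocycleClass[_surjective|_eq_zero_iff|_add|_sub]`,
`contTwoCocycles.apply_one_left/right` (ContinuousH2), `mul_self_eq_one_of_natCard_le_two`,
`eq_of_ne_one_of_natCard_le_two` (ContinuousH1OrderTwo),
`finite_absoluteGaloisGroup_completion_infinitePlace`,
`natCard_absoluteGaloisGroup_completion_infinitePlace_le_two` (TateH2VanishingArchimedean),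
`mu_absGaloisRestrict_eq_neg_infinitePlace` (ArchimedeanLocalDuality), `localInvariantMap`,
`localInvariantMap_bijective` (LocalInvariantMap), `LocalInvariants.isPerfect_of_bijective`,
`poitouTate_sum_localTatePairing_eq_zero_of_sumInvLocalizationEqZero` (PoitouTateIsPerfect).
-/

noncomputable section

open Function NumberField IsDedekindDomain
open scoped NumberField

universe u v

/-! ### The diagonal of a `2`-cocycle of a group of order `≤ 2` -/

namespace Literature.NumberTheory.GaloisRepresentations

open _root_.TopRep

section OrderTwo

variable {R : Type v} [CommRing R] [TopologicalSpace R]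
variable {G : Type u} [Group G] [TopologicalSpace G] [IsTopologicalGroup G]
variable (X : TopRep.{u} R G)

open scoped Classical in
/-- **The diagonal `φ(c, c) + φ(1, 1)` of a continuous `2`-cocycle** `φ` of `G` with values in the
topological `G`-module `X`, where `c` is a non-trivial element of `G` (chosen; unique when
`|G| ≤ 2`), and `0` if `G` is trivial.  For `G = {1, c}` of order two this is the cocycle-level
formula for the classical isomorphism `H²(G, A) ⥲ A^G/N_G A = Ĥ⁰(G, A)`, `[φ] ↦ φ(c, c) + φ(1, 1)`
(inhomogeneous normalisation `f(σ, τ) = σ b(τ) - b(στ) + b(σ)` for coboundaries).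
Ref: Serre, *Corps locaux*, VIII §4 (cohomology of finite cyclic groups); Milne, *ADT* I Thm. 2.13
("can be proved by direct calculation"). [cite: MilneADT2006, Ch. I, Thm. 2.13] -/
def twoCocycleDiagonal (φ : contTwoCocycles X) : X :=
  if h : ∃ c : G, c ≠ 1 then φ.1 (h.choose, h.choose) + φ.1 (1, 1) else 0

variable {X}

omit [IsTopologicalGroup G] in
/-- For `|G| ≤ 2` and `c ≠ 1`: `twoCocycleDiagonal φ = φ(c, c) + φ(1, 1)`.
[cite: MilneADT2006, Ch. I, Thm. 2.13] -/
theorem twoCocycleDiagonal_of_ne_one [Finite G] (hG : Nat.card G ≤ 2) {c : G} (hc : c ≠ 1)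
    (φ : contTwoCocycles X) : twoCocycleDiagonal X φ = φ.1 (c, c) + φ.1 (1, 1) := by
  classical
  have h : ∃ c : G, c ≠ 1 := ⟨c, hc⟩
  rw [twoCocycleDiagonal, dif_pos h, eq_of_ne_one_of_natCard_le_two hG h.choose_spec hc]

omit [IsTopologicalGroup G] in
/-- For trivial `G`: `twoCocycleDiagonal φ = 0` (and indeed `H²(1, A) = 0`).
[cite: MilneADT2006, Ch. I, Thm. 2.13] -/
theorem twoCocycleDiagonal_of_forall_eq_one (h : ∀ σ : G, σ = 1) (φ : contTwoCocycles X) :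
    twoCocycleDiagonal X φ = 0 := by
  classical
  have h' : ¬ ∃ c : G, c ≠ 1 := fun ⟨c, hc⟩ => hc (h c)
  rw [twoCocycleDiagonal, dif_neg h']

omit [IsTopologicalGroup G] in
/-- `twoCocycleDiagonal` is additive. [cite: MilneADT2006, Ch. I, Thm. 2.13] -/
theorem twoCocycleDiagonal_add (φ ψ : contTwoCocycles X) :
    twoCocycleDiagonal X (φ + ψ) = twoCocycleDiagonal X φ + twoCocycleDiagonal X ψ := by
  classical
  by_cases h : ∃ c : G, c ≠ 1
  · simp only [twoCocycleDiagonal, dif_pos h, Submodule.coe_add, ContinuousMap.add_apply]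
    abel
  · simp only [twoCocycleDiagonal, dif_neg h, add_zero]

omit [IsTopologicalGroup G] in
/-- `twoCocycleDiagonal` commutes with subtraction. [cite: MilneADT2006, Ch. I, Thm. 2.13] -/
theorem twoCocycleDiagonal_sub (φ ψ : contTwoCocycles X) :
    twoCocycleDiagonal X (φ - ψ) = twoCocycleDiagonal X φ - twoCocycleDiagonal X ψ := by
  rw [eq_sub_iff_add_eq, ← twoCocycleDiagonal_add, sub_add_cancel]

/-- **The diagonal kills coboundaries** (group of order `≤ 2` whose non-trivial element acts as
`-1` on `X`): if `[φ] = 0` in `H²(G, X)` then `twoCocycleDiagonal φ = 0`.  Indeed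
`φ(σ, τ) = σ b(τ) - b(στ) + b(σ)` gives `φ(c, c) + φ(1, 1) = (c b(c) - b(1) + b(c)) + b(1) =
(1 + c) b(c) = 0`.  Ref: Serre, *Corps locaux* VIII §4; Milne, *ADT* I Thm. 2.13.
[cite: MilneADT2006, Ch. I, Thm. 2.13] -/
theorem twoCocycleDiagonal_eq_zero_of_twoCocycleClass_eq_zero [Finite G] (hG : Nat.card G ≤ 2)
    (hX : ∀ c : G, c ≠ 1 → ∀ x : X, X.ρ c x = -x) (φ : contTwoCocycles X)
    (h0 : twoCocycleClass X φ = 0) : twoCocycleDiagonal X φ = 0 := by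
  by_cases h : ∃ c : G, c ≠ 1
  · obtain ⟨c, hc⟩ := h
    obtain ⟨b, hb⟩ := (twoCocycleClass_eq_zero_iff X φ).1 h0
    have h1 : X.ρ (1 : G) = 1 := map_one X.ρ
    rw [twoCocycleDiagonal_of_ne_one hG hc, hb c c, hb 1 1, mul_self_eq_one_of_natCard_le_two hG c,
      mul_one, h1, one_apply_eq_self, hX c hc]
    abel
  · push Not at h
    exact twoCocycleDiagonal_of_forall_eq_one h φ

/-- **A `2`-cocycle with vanishing diagonal is a coboundary** (group `{1, c}` of order two whose
non-trivial element acts as `-1` on `X`): if `φ(c, c) + φ(1, 1) = 0` then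
`φ(σ, τ) = σ a - a + a` for the constant cochain `a = φ(1, 1)`, by `φ(1, τ) = φ(1, 1)`,
`φ(c, 1) = c φ(1, 1)` (`contTwoCocycles.apply_one_left/right`) and `φ(c, c) = -φ(1, 1) = c φ(1, 1)`.
Hence the diagonal is INJECTIVE on `H²`.  Ref: Serre, *Corps locaux* VIII §4; Milne, *ADT* I
Thm. 2.13 (a) (`H²(Gal(ℂ/ℝ), μₙ)` has order `≤ 2`). [cite: MilneADT2006, Ch. I, Thm. 2.13] -/
theorem twoCocycleClass_eq_zero_of_twoCocycleDiagonal_eq_zero [Finite G] (hG : Nat.card G ≤ 2)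
    {c : G} (hc : c ≠ 1) (hX : ∀ x : X, X.ρ c x = -x) (φ : contTwoCocycles X)
    (h0 : twoCocycleDiagonal X φ = 0) : twoCocycleClass X φ = 0 := by
  rw [twoCocycleDiagonal_of_ne_one hG hc] at h0
  have hcc : φ.1 (c, c) = X.ρ c (φ.1 (1, 1)) := by
    rw [hX]
    exact eq_neg_of_add_eq_zero_left h0
  rw [twoCocycleClass_eq_zero_iff]
  refine ⟨ContinuousMap.const G (φ.1 (1, 1)), fun σ τ => ?_⟩
  simp only [ContinuousMap.const_apply, sub_add_cancel]
  rcases eq_or_ne σ 1 with rfl | hσ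
  · have h1 : X.ρ (1 : G) = 1 := map_one X.ρ
    rw [contTwoCocycles.apply_one_left, h1, one_apply_eq_self]
  · obtain rfl : σ = c := eq_of_ne_one_of_natCard_le_two hG hσ hc
    rcases eq_or_ne τ 1 with rfl | hτ
    · exact contTwoCocycles.apply_one_right φ σ
    · obtain rfl : τ = σ := eq_of_ne_one_of_natCard_le_two hG hτ hσ
      exact hcc

end OrderTwo

end Literature.NumberTheory.GaloisRepresentations

/-! ### The invariant map at an infinite place of a number field -/

namespace Literature.NumberTheory.GaloisCohomology

open Literature.NumberTheory.GaloisRepresentations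
open Literature.NumberTheory.GaloisRepresentations.DiscreteGaloisModule (mu MuCarrier)

section Mu

variable (K : Type u) [Field K] [CharZero K] (n : ℕ) [NeZero n]

/-- **A group isomorphism `μₙ(K̄) ≃ ℤ/n`** (`μₙ(K̄)` is cyclic of order `n` in characteristic `0`;
the isomorphism is a choice of generator — the pattern of `ArchimedeanLocalDuality`).  Plumbing for
`archimedeanInvariantMap`; only its values on `μₙ[2]`, which do not depend on the choice, occur.
[folklore] -/
def muCarrierZModEquiv : MuCarrier K n ≃+ ZMod n :=
  haveI : NeZero (n : AlgebraicClosure K) := ⟨Nat.cast_ne_zero.2 (NeZero.ne n)⟩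
  haveI : IsAddCyclic (MuCarrier K n) :=
    inferInstanceAs (IsAddCyclic (Additive (rootsOfUnity n (AlgebraicClosure K))))
  have hcard : Nat.card (MuCarrier K n) = n :=
    HasEnoughRootsOfUnity.natCard_rootsOfUnity (AlgebraicClosure K) n
  (zmodAddCyclicAddEquiv (G := MuCarrier K n) inferInstance).symm.trans
    (ZMod.ringEquivCongr hcard).toAddEquiv

end Mu

section Infinite

-- As in `PoitouTate.lean` / `ArchimedeanLocalDuality.lean`: the cochain models of `H²` need
-- `LocallyCompactSpace Γ_{K_w}`, supplied by `absoluteGaloisGroup_compactSpace` (every field).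
-- Local to this file, no override.
attribute [local instance] absoluteGaloisGroup_compactSpace

variable (K : Type u) [Field K] [NumberField K] (n : ℕ) [NeZero n] (w : InfinitePlace K)

/-- The non-trivial elements of `Γ_{K_w}` act as `-1` on the localised roots of unity
`μₙ(K̄)|_{Γ_{K_w}}` (the topological representation underlying `(mu K n).toLocal (Sum.inl w)`;
`Place.Completion (Sum.inl w)` is `w.Completion`). [cite: MilneADT2006, Ch. I, Thm. 2.13] -/
theorem toLocal_inl_rho_eq_neg {c : Field.absoluteGaloisGroup (Place.Completion (Sum.inl w))}
    (hc : c ≠ 1) (x : ((mu K n).toLocal (Sum.inl w)).toTopRep) :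
    ((mu K n).toLocal (Sum.inl w)).toTopRep.ρ c x = -x := by
  change mu K n (absGaloisRestrict K w.Completion c) x = -x
  exact mu_absGaloisRestrict_eq_neg_infinitePlace w hc x

/-- `Γ_{K_w}` is finite (order `≤ 2`), on the nose of `Place.Completion (Sum.inl w)`.
[cite: SerreGaloisCohomology1997, I §2.4] -/
theorem finite_absoluteGaloisGroup_placeCompletion_inl :
    Finite (Field.absoluteGaloisGroup (Place.Completion (Sum.inl w))) :=
  finite_absoluteGaloisGroup_completion_infinitePlace w

/-- `|Γ_{K_w}| ≤ 2`, on the nose of `Place.Completion (Sum.inl w)`.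
[cite: SerreGaloisCohomology1997, I §2.4] -/
theorem natCard_absoluteGaloisGroup_placeCompletion_inl_le_two :
    Nat.card (Field.absoluteGaloisGroup (Place.Completion (Sum.inl w))) ≤ 2 :=
  natCard_absoluteGaloisGroup_completion_infinitePlace_le_two w

/-- Well-definedness: two cocycles with the same class have the same diagonal (at an infinite
place: `|Γ_{K_w}| ≤ 2`, non-trivial elements act as `-1`). [cite: MilneADT2006, Ch. I, Thm. 2.13] -/
theorem twoCocycleDiagonal_eq_of_twoCocycleClass_eq
    (φ ψ : contTwoCocycles ((mu K n).toLocal (Sum.inl w)).toTopRep)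
    (h : twoCocycleClass _ φ = twoCocycleClass _ ψ) :
    twoCocycleDiagonal _ φ = twoCocycleDiagonal _ ψ := by
  haveI := finite_absoluteGaloisGroup_placeCompletion_inl K w
  have hG := natCard_absoluteGaloisGroup_placeCompletion_inl_le_two K w
  rw [← sub_eq_zero, ← twoCocycleDiagonal_sub]
  refine twoCocycleDiagonal_eq_zero_of_twoCocycleClass_eq_zero hG
    (fun c hc x => toLocal_inl_rho_eq_neg K n w hc x) _ ?_
  rw [twoCocycleClass_sub, h, sub_self]

/-- **The local invariant map at the infinite place `w`**, `inv_w : H²(K_w, μₙ) → ℤ/n`, on the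
tree's localised coefficients `μₙ(K̄)|_{Γ_{K_w}}`: a class `[φ]` is sent to its diagonal
`φ(c, c) + φ(1, 1) ∈ μₙ^{Γ_{K_w}} = μₙ[2]` read in `ℤ/n` (`muCarrierZModEquiv`), i.e. to `0` or `n/2`;
for trivial `Γ_{K_w}` (complex place) the map is `0`.  This is the composite
`H²(K_w, μₙ) ↪ Br(K_w) —inv_w→ ½ℤ/ℤ ⊂ (1/n)ℤ/ℤ = ℤ/n` of the sources ("the unique injection" at a
real place).  Well defined by `twoCocycleDiagonal_eq_of_twoCocycleClass_eq`
(`archimedeanInvariantMap_twoCocycleClass`).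
Ref: Milne, *ADT* (2006), I Ex. 1.6 (c), Thm. 2.13 (a); Serre, *Corps locaux* XIII §3 Remarque;
Cassels–Fröhlich VII §11.2. [cite: MilneADT2006, Ch. I, Ex. 1.6 (c)] -/
def archimedeanInvariantMap : galoisCohomology ((mu K n).toLocal (Sum.inl w)) 2 →+ ZMod n where
  toFun x := muCarrierZModEquiv K n (twoCocycleDiagonal _
    (twoCocycleClass_surjective ((mu K n).toLocal (Sum.inl w)).toTopRep x).choose)
  map_zero' := by
    haveI := finite_absoluteGaloisGroup_placeCompletion_inl K w
    have hG := natCard_absoluteGaloisGroup_placeCompletion_inl_le_two K w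
    rw [AddEquiv.map_eq_zero_iff]
    exact twoCocycleDiagonal_eq_zero_of_twoCocycleClass_eq_zero hG
      (fun c hc x => toLocal_inl_rho_eq_neg K n w hc x) _
      (twoCocycleClass_surjective ((mu K n).toLocal (Sum.inl w)).toTopRep 0).choose_spec
  map_add' x y := by
    rw [← map_add, ← twoCocycleDiagonal_add]
    refine congrArg (muCarrierZModEquiv K n)
      (twoCocycleDiagonal_eq_of_twoCocycleClass_eq K n w _ _ ?_)
    rw [twoCocycleClass_add,
      (twoCocycleClass_surjective ((mu K n).toLocal (Sum.inl w)).toTopRep (x + y)).choose_spec,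
      (twoCocycleClass_surjective ((mu K n).toLocal (Sum.inl w)).toTopRep x).choose_spec,
      (twoCocycleClass_surjective ((mu K n).toLocal (Sum.inl w)).toTopRep y).choose_spec]
    rfl

variable {K n w}

/-- Unfolding `archimedeanInvariantMap` on a class, with the chosen representative. [folklore] -/
private theorem archimedeanInvariantMap_apply (x : galoisCohomology ((mu K n).toLocal (Sum.inl w)) 2) :
    archimedeanInvariantMap K n w x = muCarrierZModEquiv K n (twoCocycleDiagonal _
      (twoCocycleClass_surjective ((mu K n).toLocal (Sum.inl w)).toTopRep x).choose) := rfl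

/-- **`inv_w [φ] = φ(c, c) + φ(1, 1)` read in `ℤ/n`** — the value of `archimedeanInvariantMap` on the
class of a cocycle. [cite: MilneADT2006, Ch. I, Thm. 2.13] -/
theorem archimedeanInvariantMap_twoCocycleClass
    (φ : contTwoCocycles ((mu K n).toLocal (Sum.inl w)).toTopRep) :
    archimedeanInvariantMap K n w (twoCocycleClass _ φ) =
      muCarrierZModEquiv K n (twoCocycleDiagonal _ φ) := by
  rw [archimedeanInvariantMap_apply]
  congr 1
  exact twoCocycleDiagonal_eq_of_twoCocycleClass_eq K n w _ _
    (twoCocycleClass_surjective ((mu K n).toLocal (Sum.inl w)).toTopRep (twoCocycleClass _ φ)).choose_spec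

/-- **At a place with trivial `Γ_{K_w}` (a complex place) `inv_w = 0`** (and `H²(K_w, μₙ) = 0`).
[cite: MilneADT2006, Ch. I, Ex. 1.6 (c)] -/
theorem archimedeanInvariantMap_eq_zero_of_forall_eq_one
    (h : ∀ σ : Field.absoluteGaloisGroup (Place.Completion (Sum.inl w)), σ = 1)
    (x : galoisCohomology ((mu K n).toLocal (Sum.inl w)) 2) : archimedeanInvariantMap K n w x = 0 := by
  obtain ⟨φ, rfl⟩ := twoCocycleClass_surjective ((mu K n).toLocal (Sum.inl w)).toTopRep x
  rw [archimedeanInvariantMap_twoCocycleClass, twoCocycleDiagonal_of_forall_eq_one h, map_zero]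

/-- **`inv_w` is injective as soon as `Γ_{K_w}` is non-trivial** (a real place: "the unique
injection `Br(ℝ)[n] ↪ ℤ/n`", Milne I Ex. 1.6 (c); `H²(Gal(ℂ/ℝ), μₙ)` has order `2` or `1` as `n` is
even or odd, Thm. 2.13 (a)): a class with vanishing diagonal is zero
(`twoCocycleClass_eq_zero_of_twoCocycleDiagonal_eq_zero`). [cite: MilneADT2006, Ch. I, Ex. 1.6 (c)] -/
theorem archimedeanInvariantMap_injective_of_ne_one
    {c : Field.absoluteGaloisGroup (Place.Completion (Sum.inl w))} (hc : c ≠ 1) :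
    Injective (archimedeanInvariantMap K n w) := by
  haveI := finite_absoluteGaloisGroup_placeCompletion_inl K w
  have hG := natCard_absoluteGaloisGroup_placeCompletion_inl_le_two K w
  refine (injective_iff_map_eq_zero _).2 fun x hx => ?_
  obtain ⟨φ, rfl⟩ := twoCocycleClass_surjective ((mu K n).toLocal (Sum.inl w)).toTopRep x
  rw [archimedeanInvariantMap_twoCocycleClass, AddEquiv.map_eq_zero_iff] at hx
  exact twoCocycleClass_eq_zero_of_twoCocycleDiagonal_eq_zero hG hc
    (fun y => toLocal_inl_rho_eq_neg K n w hc y) φ hx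

/-- **At a REAL place `w`, `Γ_{K_w}` is non-trivial**: `K_w ≅ ℝ`
(`InfinitePlace.Completion.ringEquivRealOfIsReal`), `ℂ` is an algebraic closure of `K_w` of degree
`2`, and complex conjugation — `K_w`-linear since the structure map factors through `ℝ` —
transported to `K̄_w` along `K̄_w ≃ ℂ` (`IsAlgClosure.equiv`) is a non-trivial element (it moves a
square root of `-1`).  Ref: Serre, *Cohomologie galoisienne* I §2.4 (`G = Gal(ℂ/ℝ)`).
[cite: SerreGaloisCohomology1997, I §2.4] -/
theorem exists_ne_one_absoluteGaloisGroup_of_isReal {w : InfinitePlace K} (hw : w.IsReal) :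
    ∃ c : Field.absoluteGaloisGroup (Place.Completion (Sum.inl w)), c ≠ 1 := by
  change ∃ c : Field.absoluteGaloisGroup w.Completion, c ≠ 1
  let e : w.Completion ≃+* ℝ := InfinitePlace.Completion.ringEquivRealOfIsReal hw
  letI : Algebra w.Completion ℂ := (Complex.ofRealHom.comp e.toRingHom).toAlgebra
  have hrank : Module.finrank w.Completion ℂ = 2 := by
    rw [Algebra.finrank_eq_of_equiv_equiv e (RingEquiv.refl ℂ) (by ext; rfl),
      Complex.finrank_real_complex]
  haveI : FiniteDimensional w.Completion ℂ :=
    Module.finite_of_finrank_pos (by rw [hrank]; exact two_pos)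
  haveI : IsAlgClosure w.Completion ℂ := ⟨Complex.isAlgClosed, Algebra.IsAlgebraic.of_finite _ _⟩
  let φ : AlgebraicClosure w.Completion ≃ₐ[w.Completion] ℂ := IsAlgClosure.equiv w.Completion _ ℂ
  -- complex conjugation as a `K_w`-algebra automorphism of `ℂ`
  have hconj : ∀ a : w.Completion,
      Complex.conjAe.toRingEquiv (algebraMap w.Completion ℂ a) = algebraMap w.Completion ℂ a :=
    fun a => by
      change Complex.conjAe (Complex.ofRealHom (e a)) = Complex.ofRealHom (e a)
      rw [Complex.conjAe_coe]
      exact Complex.conj_ofReal _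
  let κ : ℂ ≃ₐ[w.Completion] ℂ := AlgEquiv.ofRingEquiv hconj
  have hκ : ∀ z : ℂ, κ z = starRingEnd ℂ z := fun z => by
    change Complex.conjAe z = _
    rw [Complex.conjAe_coe]
  let ψ : AlgebraicClosure w.Completion ≃ₐ[w.Completion] AlgebraicClosure w.Completion :=
    φ.trans (κ.trans φ.symm)
  refine ⟨(Field.absoluteGaloisGroup.toAlgEquiv w.Completion).symm ψ, fun h1 => ?_⟩
  have hz := congrArg (fun τ : Field.absoluteGaloisGroup w.Completion => τ • φ.symm Complex.I) h1
  simp only [one_smul, Field.absoluteGaloisGroup.toAlgEquiv_symm_apply] at hz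
  -- `hz : ψ (φ⁻¹ i) = φ⁻¹ i`, i.e. `conj i = i`
  have hI : κ Complex.I = Complex.I := by
    have h := congrArg φ hz
    have h' : φ (ψ (φ.symm Complex.I)) = κ Complex.I := by
      change φ (φ.symm (κ (φ (φ.symm Complex.I)))) = κ Complex.I
      rw [AlgEquiv.apply_symm_apply, AlgEquiv.apply_symm_apply]
    rw [h', AlgEquiv.apply_symm_apply] at h
    exact h
  rw [hκ, Complex.conj_I] at hI
  have him := congrArg Complex.im hI
  norm_num at him

/-- **At a real place `inv_w` is injective** ("the unique injection `Br(ℝ)[n] ↪ ℤ/n`").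
[cite: MilneADT2006, Ch. I, Ex. 1.6 (c)] -/
theorem archimedeanInvariantMap_injective_of_isReal (hw : w.IsReal) :
    Injective (archimedeanInvariantMap K n w) := by
  obtain ⟨c, hc⟩ := exists_ne_one_absoluteGaloisGroup_of_isReal hw
  exact archimedeanInvariantMap_injective_of_ne_one hc

end Infinite

/-! ### THE family of local invariant maps and the reduction of the Poitou–Tate fact -/

namespace LocalInvariants

variable (K : Type u) [Field K] [NumberField K] (n : ℕ) [NeZero n]

/-- **The family of local invariant maps of the global class formation at level `n`**: at a finite
place `v` THE residue map `localInvariantMap K n v : H²(K_v, μₙ) ⥲ ℤ/n` of local class field theory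
(unramified normalisation), at an infinite place `w` the map `archimedeanInvariantMap K n w`
(`[φ] ↦ φ(c, c) + φ(1, 1)`, the injection `Br(ℝ)[n] ↪ ℤ/n` at a real place, `0` at a complex one).
This is the inhabitant that the tree's named fact `poitouTate_sum_localTatePairing_eq_zero K`
asserts to exist (`poitouTate_sum_localTatePairing_eq_zero_of_canonical`).
Ref: Milne, *ADT* (2006), I §1 and Ex. 1.6 (b),(c); Harari, *Galois Cohomology and Class Field
Theory*, Thm. 8.9, Prop. 8.13; Tate, Cassels–Fröhlich VII §11.2.
[cite: MilneADT2006, Ch. I, Ex. 1.6 (c)] -/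
def canonical : LocalInvariants K n := fun v =>
  match v with
  | Sum.inr v => localInvariantMap K n v
  | Sum.inl w => archimedeanInvariantMap K n w

variable {K n}

/-- The finite components of the canonical family are THE residue maps.
[cite: MilneADT2006, Ch. I, Ex. 1.6 (c)] -/
theorem canonical_inr (v : HeightOneSpectrum (𝓞 K)) :
    canonical K n (Sum.inr v) = localInvariantMap K n v := rfl

/-- The infinite components of the canonical family are the archimedean invariant maps.
[cite: MilneADT2006, Ch. I, Ex. 1.6 (c)] -/
theorem canonical_inl (w : InfinitePlace K) :
    canonical K n (Sum.inl w) = archimedeanInvariantMap K n w := rfl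

/-- **The canonical family is a local Tate duality at the finite places** (`IsPerfect`).
Ref: Milne, *ADT* (2006), I Cor. 2.3. [cite: MilneADT2006, Ch. I, Cor. 2.3] -/
theorem canonical_isPerfect : (canonical K n).IsPerfect :=
  isPerfect_of_eq_localInvariantMap _ fun _ => rfl

/-- The canonical family is injective at every infinite place whose local Galois group is
non-trivial (every real place: complex conjugation; cf. `LocalInvariants.InjectiveAtRealPlaces`).
[cite: MilneADT2006, Ch. I, Ex. 1.6 (c)] -/
theorem canonical_injective_inl_of_ne_one (w : InfinitePlace K)
    {c : Field.absoluteGaloisGroup (Place.Completion (Sum.inl w))} (hc : c ≠ 1) :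
    Injective (canonical K n (Sum.inl w)) :=
  archimedeanInvariantMap_injective_of_ne_one hc

/-- **The canonical family is injective at the real places** (`LocalInvariants.InjectiveAtRealPlaces`,
the clause of the sibling fact `poitouTate_selmerStructure_duality_real`; Milne I Ex. 1.6 (c): at a
real prime `inv_v` "is the unique injection"). [cite: MilneADT2006, Ch. I, Ex. 1.6 (c)] -/
theorem canonical_injectiveAtRealPlaces : (canonical K n).InjectiveAtRealPlaces :=
  fun w hw => archimedeanInvariantMap_injective_of_isReal (K := K) (n := n) (w := w) hw

end LocalInvariants

/-- **Poitou–Tate (as vendored) ⟸ the reciprocity law `∑_v inv_v = 0` for THE invariant maps.**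
If for every `n ≥ 1` the canonical family satisfies `∑_v inv_v (loc_v c) = 0` on `H²(K, μₙ)`
(`LocalInvariants.SumInvLocalizationEqZero`: over every finite set of places outside which the terms
vanish) — the Albert–Brauer–Hasse–Noether relation for the class-field-theoretic normalisation —
then `poitouTate_sum_localTatePairing_eq_zero K` holds.  This is the exact residual statement of
the fact in the tree.  Ref: Milne, *ADT* (2006), I Thm. 4.10 (b) and its proof; Harari, *Galois
Cohomology and Class Field Theory*, Thm. 14.11, Rem. 14.12, Thm. 17.13; Tate, Cassels–Fröhlich VII
§11.2 (bis). [cite: MilneADT2006, Ch. I, Thm. 4.10(b)] -/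
theorem poitouTate_sum_localTatePairing_eq_zero_of_canonical {K : Type u} [Field K] [NumberField K]
    (h : ∀ (n : ℕ) [NeZero n], (LocalInvariants.canonical K n).SumInvLocalizationEqZero) :
    poitouTate_sum_localTatePairing_eq_zero K :=
  poitouTate_sum_localTatePairing_eq_zero_of_localInvariantMap K fun n _ =>
    ⟨LocalInvariants.canonical K n, fun _ => rfl, h n⟩

end Literature.NumberTheory.GaloisCohomology

/-! ### Complex places and the 2-torsion of the values (appended) -/

namespace Literature.NumberTheory.GaloisRepresentations

section OrderTwoInv

variable {R : Type v} [CommRing R] [TopologicalSpace R]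
variable {G : Type u} [Group G] [TopologicalSpace G] [IsTopologicalGroup G]
variable {X : TopRep.{u} R G}

omit [IsTopologicalGroup G] in
/-- **The diagonal of a `2`-cocycle is `G`-invariant**: `c · (φ(c, c) + φ(1, 1)) = φ(c, c) + φ(1, 1)`
(the cocycle identity at `(c, c, c)` with `c² = 1`, `φ(1, c) = φ(1, 1)`, `φ(c, 1) = c φ(1, 1)`), i.e.
the diagonal lies in `A^G` as it must for `H²(G, A) ≅ A^G/N_G A`.
[cite: MilneADT2006, Ch. I, Thm. 2.13] -/
theorem rho_twoCocycleDiagonal [Finite G] (hG : Nat.card G ≤ 2) (c : G) (φ : contTwoCocycles X) :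
    X.ρ c (twoCocycleDiagonal X φ) = twoCocycleDiagonal X φ := by
  rcases eq_or_ne c 1 with rfl | hc
  · rw [map_one X.ρ, one_apply_eq_self]
  · rw [twoCocycleDiagonal_of_ne_one hG hc]
    have h := φ.2 c c c
    rw [mul_self_eq_one_of_natCard_le_two hG c, contTwoCocycles.apply_one_left,
      contTwoCocycles.apply_one_right] at h
    -- h : c φ(c,c) + c φ(1,1) = φ(1,1) + φ(c,c)
    rw [map_add, h, add_comm]

omit [IsTopologicalGroup G] in
/-- If the non-trivial element acts as `-1`, the diagonal is `2`-torsion: `2 · (φ(c,c) + φ(1,1)) = 0`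
(`μₙ^{Gal(ℂ/ℝ)} = μₙ[2]`). [cite: MilneADT2006, Ch. I, Thm. 2.13] -/
theorem two_nsmul_twoCocycleDiagonal [Finite G] (hG : Nat.card G ≤ 2)
    (hX : ∀ c : G, c ≠ 1 → ∀ x : X, X.ρ c x = -x) (φ : contTwoCocycles X) :
    2 • twoCocycleDiagonal X φ = 0 := by
  by_cases h : ∃ c : G, c ≠ 1
  · obtain ⟨c, hc⟩ := h
    have h1 := rho_twoCocycleDiagonal hG c φ
    rw [hX c hc] at h1
    rw [two_nsmul]
    nth_rewrite 1 [← h1]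
    exact neg_add_cancel _
  · push Not at h
    rw [twoCocycleDiagonal_of_forall_eq_one h, nsmul_zero]

end OrderTwoInv

end Literature.NumberTheory.GaloisRepresentations

namespace Literature.NumberTheory.GaloisCohomology

open Literature.NumberTheory.GaloisRepresentations
open Literature.NumberTheory.GaloisRepresentations.DiscreteGaloisModule (mu MuCarrier)

section InfiniteValues

attribute [local instance] absoluteGaloisGroup_compactSpace

variable {K : Type u} [Field K] [NumberField K] {n : ℕ} [NeZero n] {w : InfinitePlace K}

/-- **`inv_w` takes values in the `2`-torsion `{0, n/2}` of `ℤ/n`** (`Br(ℝ) = ½ℤ/ℤ`).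
[cite: MilneADT2006, Ch. I, Ex. 1.6 (c)] -/
theorem two_nsmul_archimedeanInvariantMap (x : galoisCohomology ((mu K n).toLocal (Sum.inl w)) 2) :
    2 • archimedeanInvariantMap K n w x = 0 := by
  haveI := finite_absoluteGaloisGroup_placeCompletion_inl K w
  have hG := natCard_absoluteGaloisGroup_placeCompletion_inl_le_two K w
  obtain ⟨φ, rfl⟩ := twoCocycleClass_surjective ((mu K n).toLocal (Sum.inl w)).toTopRep x
  rw [archimedeanInvariantMap_twoCocycleClass, ← map_nsmul,
    two_nsmul_twoCocycleDiagonal hG (fun c hc y => toLocal_inl_rho_eq_neg K n w hc y), map_zero]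

/-- **At a COMPLEX place `Γ_{K_w}` is trivial**: `K_w ≅ ℂ` (`InfinitePlace.Completion.ringEquivComplexOfIsComplex`)
is an algebraic closure of itself, so every `K_w`-automorphism of `K̄_w` is the identity.
[cite: SerreGaloisCohomology1997, I §2.4] -/
theorem eq_one_absoluteGaloisGroup_of_isComplex (hw : w.IsComplex)
    (σ : Field.absoluteGaloisGroup (Place.Completion (Sum.inl w))) : σ = 1 := by
  change Field.absoluteGaloisGroup w.Completion at σ
  change σ = (1 : Field.absoluteGaloisGroup w.Completion)
  let e : w.Completion ≃+* ℂ := InfinitePlace.Completion.ringEquivComplexOfIsComplex hw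
  letI : Algebra w.Completion ℂ := e.toRingHom.toAlgebra
  have hrank : Module.finrank w.Completion ℂ = 1 := by
    rw [Algebra.finrank_eq_of_equiv_equiv e (RingEquiv.refl ℂ) (by ext; rfl), Module.finrank_self]
  haveI : FiniteDimensional w.Completion ℂ :=
    Module.finite_of_finrank_pos (by rw [hrank]; exact one_pos)
  haveI : IsAlgClosure w.Completion ℂ := ⟨Complex.isAlgClosed, Algebra.IsAlgebraic.of_finite _ _⟩
  let φ : AlgebraicClosure w.Completion ≃ₐ[w.Completion] ℂ := IsAlgClosure.equiv w.Completion _ ℂ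
  have hsurj : ∀ z : ℂ, ∃ a : w.Completion, algebraMap w.Completion ℂ a = z := fun z =>
    ⟨e.symm z, by change e (e.symm z) = z; rw [e.apply_symm_apply]⟩
  refine FaithfulSMul.eq_of_smul_eq_smul (α := AlgebraicClosure w.Completion) fun y => ?_
  rw [one_smul]
  apply φ.injective
  obtain ⟨a, ha⟩ := hsurj (φ y)
  have hy : y = algebraMap w.Completion (AlgebraicClosure w.Completion) a := by
    apply φ.injective
    rw [AlgEquiv.commutes, ha]
  rw [hy, Field.absoluteGaloisGroup.smul_def, AlgEquiv.commutes]

/-- **At a complex place `inv_w = 0`** (`Br(ℂ) = 0`). [cite: MilneADT2006, Ch. I, Ex. 1.6 (c)] -/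
theorem archimedeanInvariantMap_eq_zero_of_isComplex (hw : w.IsComplex)
    (x : galoisCohomology ((mu K n).toLocal (Sum.inl w)) 2) : archimedeanInvariantMap K n w x = 0 :=
  archimedeanInvariantMap_eq_zero_of_forall_eq_one (eq_one_absoluteGaloisGroup_of_isComplex hw) x

/-- The canonical family vanishes at the complex places. [cite: MilneADT2006, Ch. I, Ex. 1.6 (c)] -/
theorem LocalInvariants.canonical_inl_eq_zero_of_isComplex (hw : w.IsComplex)
    (x : galoisCohomology ((mu K n).toLocal (Sum.inl w)) 2) : LocalInvariants.canonical K n (Sum.inl w) x = 0 :=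
  archimedeanInvariantMap_eq_zero_of_isComplex hw x

end InfiniteValues

end Literature.NumberTheory.GaloisCohomology

end
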